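import Literature.AlgebraicGeometry.Motives.FaltingsECSemisimpleNumberFieldProofs
import Literature.NumberTheory.EllipticCurves.IsogenyQuotientCurveProofs
import Literature.NumberTheory.EllipticCurves.NeronOggShafarevichLocal
import Literature.NumberTheory.EllipticCurves.IsogenyClassFiniteProofs
import Literature.NumberTheory.EllipticCurves.InertiaInvariantsAdditiveProofs
import Literature.NumberTheory.DiophantineGeometry.SiegelIntegralPointsReduction
import Literature.NumberTheory.DiophantineGeometry.SiegelCubicReduction
import HarnessLib

/-!
# Faltings 1983, Satz 3 for an elliptic curve: the assembly keyed to its remaining inputs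
# (2026-08-14: two; 2026-08-15: one — Siegel's theorem)

Theorem-only `Proofs` companion of `Literature.AlgebraicGeometry.Motives.FaltingsEC` and
`Literature.AlgebraicGeometry.Motives.FaltingsECSemisimpleNumberFieldProofs`, concerning the
named fact `Literature.AlgebraicGeometry.Motives.isSemisimpleRepresentation_rationalGaloisRepTate W ℓ`
— Faltings, *Endlichkeitssätze*, Invent. Math. 73 (1983), §5 Satz 3 for `A = E` an elliptic
curve over a number field `K`: the `ℚ_ℓ`-representation `V_ℓ E` of `Γ_K` is semisimple (Engl.
transl.: Cornell–Silverman, *Arithmetic Geometry*, Ch. II, §5 Theorem 3, "The action of `π` on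
`T_ℓ ⊗_{ℤ_ℓ} ℚ_ℓ` is semisimple").

`FaltingsECSemisimpleNumberFieldProofs` proves every step of the printed proof for `g = 1`
(Tate's argument on the quotients `E/G_n` by the levels of the `ℓ`-divisible group of a stable
line, through Shafarevich's finiteness of the `K`-isogeny class) and ends with
`isSemisimpleRepresentation_rationalGaloisRepTate_of_siegel_of_neronOggShafarevich`, keyed to
**three** hypothesis-free named facts requested only for curves without `K`-rational complex
multiplication: Siegel's theorem (*AEC* Cor. IX.3.2.1, `WeierstrassCurve.siegel_finite_integralPoints K`),
the criterion of Néron–Ogg–Shafarevich (*AEC* Thm. VII.7.1 (c) ⇒ (a),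
`WeierstrassCurve.neronOggShafarevich`) and the separable quotient isogeny (*AEC* Prop. III.4.12,
`WeierstrassCurve.exists_separable_isogeny_ker_eq W`). The third is now a **theorem** of the tree
(`WeierstrassCurve.exists_separable_isogeny_ker_eq_holds`, with the quotient + dual package
`WeierstrassCurve.exists_isogeny_ker_eq_and_comp_eq_nsmul_holds`, file
`Literature.NumberTheory.EllipticCurves.IsogenyQuotientCurveProofs`: the curve `E/S` with function
field `K̄(E)^S`, made explicit on the Weierstrass model). This file records the consequence:
Satz 3 for `E` is keyed to **two** inputs, in each of the forms in which the tree currently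
states them.

## Contents (all proved; each hypothesis is requested only for curves without `K`-rational CM,
the CM case being the tree's `isSemisimpleRepresentation_rationalGaloisRepTate_holds_of_hasRationalCM`)

* `isSemisimpleRepresentation_rationalGaloisRepTate_of_isogenyClass`: Satz 3 for `E` from
  Shafarevich's finiteness of the `K`-isogeny class alone (`WeierstrassCurve.finite_isogenyClass W`,
  *AEC* Cor. IX.6.2).
* `isSemisimpleRepresentation_rationalGaloisRepTate_of_shafarevich_of_badPlaces`: from
  Shafarevich's Thm. IX.6.1 (`WeierstrassCurve.shafarevich_finite_goodReductionOutside K`) and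
  the isogeny invariance of the bad places (*AEC* Cor. VII.7.2,
  `WeierstrassCurve.IsIsogenous.badPlaces_eq W W'`).
* `isSemisimpleRepresentation_rationalGaloisRepTate_of_siegel_of_badPlaces`: from Siegel's
  theorem (Cor. IX.3.2.1) and Cor. VII.7.2.
* `isSemisimpleRepresentation_rationalGaloisRepTate_of_shafarevich_of_criterion`,
  `isSemisimpleRepresentation_rationalGaloisRepTate_of_siegel_of_criterion`: with Cor. VII.7.2
  supplied by the criterion of Néron–Ogg–Shafarevich (`WeierstrassCurve.neronOggShafarevich`,
  Thm. VII.7.1 (c) ⇒ (a)) for the curves over `K`.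
* `isSemisimpleRepresentation_rationalGaloisRepTate_of_siegel_of_localCriterion`: with the
  criterion in its local torsion form Thm. VII.7.1 (d) ⇒ (a)
  (`WeierstrassCurve.hasGoodReductionAt_of_infinite_unramifiedTorsion`, file
  `NeronOggShafarevichLocal`, one level below `neronOggShafarevich`).
(The criterion also follows from the tame conductor exponents at the bad places, Silverman,
*ATAEC*, Thm. IV.10.2(a) — the named facts of `HasseWeilAbelianConductor` — by the tree's
`WeierstrassCurve.neronOggShafarevich_of_codimFixed_facts` (`NeronOggShafarevichProofs`), which
composes with `…_of_siegel_of_criterion` over a number field.)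

## Status of the discharge (tree, 2026-08-14)

`isSemisimpleRepresentation_rationalGaloisRepTate_holds` is any one of the theorems below applied
to the discharges of its hypotheses; none of these is in the tree yet:

* Siegel's theorem *AEC* IX.3.2.1 (Roth's theorem IX.1.4 + weak Mordell–Weil; or Baker) —
  equivalently for the present purpose Shafarevich's Thm. IX.6.1, or Faltings' own route
  (Satz 1 + Satz 2: the moduli height on `A_g` and Tate–Raynaud on `p`-divisible groups), or
  directly Cor. IX.6.2 for the curve at hand;
* the criterion of Néron–Ogg–Shafarevich VII.7.1 (c) ⇒ (a) (Kodaira–Néron VII.6.1, VII.2.1,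
  VII.3.1, VII.5.1), or only its corollary VII.7.2 for the curves `K`-isogenous to `E`.

## One remaining input (tree, 2026-08-15)

The second bullet is settled: the criterion of Néron–Ogg–Shafarevich is a **theorem** of the
tree (`WeierstrassCurve.neronOggShafarevich_holds`, file
`Literature.NumberTheory.EllipticCurves.InertiaInvariantsAdditiveProofs`, through Silverman
*ATAEC* Thm. IV.10.2(a) at the multiplicative and additive places), and so is Cor. VII.7.2
(`WeierstrassCurve.IsIsogenous.badPlaces_eq_holds`, `ShafarevichGoodReductionBadPlacesProofs`),
whence Cor. IX.6.2 from Thm. IX.6.1 alone and from Siegel's theorem alone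
(`WeierstrassCurve.finite_isogenyClass_of_shafarevich`, `WeierstrassCurve.finite_isogenyClass_of_siegel`,
`IsogenyClassFiniteProofs`).  The last section of this file records the consequence — Satz 3 for
`E` is keyed to **one** input, Siegel's theorem, in each form in which the tree states it:

* `isSemisimpleRepresentation_rationalGaloisRepTate_of_shafarevich'`: from Shafarevich's
  Thm. IX.6.1 for `K` alone (`WeierstrassCurve.shafarevich_finite_goodReductionOutside K`);
* `isSemisimpleRepresentation_rationalGaloisRepTate_of_siegel`: from Siegel's theorem for `K`
  alone (`WeierstrassCurve.siegel_finite_integralPoints K`, *AEC* Cor. IX.3.2.1) — **the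
  discharge is `…_of_siegel W ℓ fun _ ↦ siegel_finite_integralPoints_holds K` as soon as that
  theorem exists**;
* `isSemisimpleRepresentation_rationalGaloisRepTate_of_hyperellipticCubic`: from Siegel's
  Thm. IX.4.3 for the split monic cubics `y² = (x - e₁)(x - e₂)(x - e₃)` over the number fields
  (the hypothesis `H` of the tree's `WeierstrassCurve.siegel_finite_integralPoints_of_cubic`,
  `SiegelIntegralPointsReduction`: Cor. IX.4.3.1 / IX.3.2.2);
* `isSemisimpleRepresentation_rationalGaloisRepTate_of_unitEquation`: from the `S`-unit equation
  *AEC* Thm. IX.4.1 with `a = b = 1` over the number fields (the hypothesis `U` of the tree's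
  `Literature.NumberTheory.DiophantineGeometry.finite_integer_sq_eq_cubic_of_unitEquation`,
  `SiegelCubicReduction`) — the one deep Diophantine input left below Satz 3 for `E` in the tree
  (Siegel–Mahler; Roth's theorem IX.1.4 or linear forms in logarithms, neither in Mathlib).

As everywhere in this file, each hypothesis is requested only for curves without `K`-rational
CM.

## References

* [Faltings1983Endlichkeit] G. Faltings, *Endlichkeitssätze für abelsche Varietäten über
  Zahlkörpern*, Invent. Math. 73 (1983), 349–366, §5 Satz 3 and the proof of Sätze 3–4; Engl.
  transl. in G. Cornell, J. H. Silverman (eds.), *Arithmetic Geometry*, Springer 1986, Ch. II, §5,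
  Theorem 3 (held copy `book:cornellnd-arithmetic-geometry`, PDF pp. 89–90).
* [SilvermanAEC2009] J. H. Silverman, *The Arithmetic of Elliptic Curves*, 2nd ed., GTM 106:
  Prop. III.4.12, Thm. III.7.4, Thm. VII.7.1, Cor. VII.7.2, Cor. IX.3.2.1, Cor. IX.3.2.2,
  Thm. IX.4.1, Thm. IX.4.3, Cor. IX.4.3.1, Thm. IX.6.1, Cor. IX.6.2.
* [SilvermanATAEC1994] J. H. Silverman, *Advanced Topics in the Arithmetic of Elliptic Curves*,
  GTM 151, Thm. IV.10.2(a).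

## Design

Theorems only, no definitions, no instances; `noncomputable section`, one universe `u`,
`namespace Literature.AlgebraicGeometry.Motives`, base field `K : Type u` with the instance
hypotheses `[NumberField K] [W.IsElliptic]` inside the named facts as in `FaltingsEC`. Each
theorem is a one-line composition of the tree's reductions.
-/

noncomputable section

universe u

namespace Literature.AlgebraicGeometry.Motives

open WeierstrassCurve NumberField IsDedekindDomain

variable {K : Type u} [Field K] (W : WeierstrassCurve K) (ℓ : ℕ) [Fact ℓ.Prime]

/-- **Faltings' Satz 3 for an elliptic curve from Shafarevich's finiteness of the isogeny class
alone.** The named fact `isSemisimpleRepresentation_rationalGaloisRepTate W ℓ` (for `E` elliptic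
over a number field `K`, `V_ℓ E` is a semisimple `Γ_K`-representation) follows from
`WeierstrassCurve.finite_isogenyClass W` (Silverman, *AEC*, Cor. IX.6.2: the curves `K`-isogenous
to `E` fall into finitely many `K`-isomorphism classes — for abelian varieties Faltings'
Sätze 1–2 as used in the proof of Satz 3), requested only when `E` has no `K`-rational complex
multiplication. The other two inputs of the printed proof for `g = 1` are theorems of the tree:
the quotient isogenies `E → E/G_n` over `K` (`WeierstrassCurve.exists_separable_isogeny_ker_eq_holds`,
*AEC* III.4.12) and *AEC* III.7.4 (`linearIndependent_tateModule_map_holds`).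
[cite: Faltings1983Endlichkeit, §5 Satz 3 (proof)] -/
theorem isSemisimpleRepresentation_rationalGaloisRepTate_of_isogenyClass
    (hS : ¬ W.HasRationalCM → W.finite_isogenyClass) :
    isSemisimpleRepresentation_rationalGaloisRepTate W ℓ :=
  isSemisimpleRepresentation_rationalGaloisRepTate_of_finite_isogenyClass_of_separable_quotient
    W ℓ hS fun _ ↦ exists_separable_isogeny_ker_eq_holds W

/-- **Faltings' Satz 3 for an elliptic curve, down to Shafarevich's Thm. IX.6.1 and the isogeny
invariance of the bad places.** The named fact `isSemisimpleRepresentation_rationalGaloisRepTate W ℓ`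
follows from Shafarevich's theorem for the number field `K` (`hSha`, Silverman, *AEC*,
Thm. IX.6.1: finitely many `K`-isomorphism classes of elliptic curves with good reduction
outside a finite set of places) and the equality of the bad places of the curves `K`-isogenous to
`E` (`hbad`, *AEC* Cor. VII.7.2), both requested only for curves without `K`-rational CM;
Cor. IX.6.2 is then `WeierstrassCurve.exists_finset_variableChange_of_isIsogenous_of_facts`, the
quotient isogenies are `WeierstrassCurve.exists_isogeny_ker_eq_and_comp_eq_nsmul_holds` and
*AEC* III.7.4 is `linearIndependent_tateModule_map_holds`.
[cite: Faltings1983Endlichkeit, §5 Satz 3 (proof)] -/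
theorem isSemisimpleRepresentation_rationalGaloisRepTate_of_shafarevich_of_badPlaces
    (hSha : ¬ W.HasRationalCM → shafarevich_finite_goodReductionOutside K)
    (hbad : ¬ W.HasRationalCM → ∀ W' : WeierstrassCurve K, IsIsogenous.badPlaces_eq W W') :
    isSemisimpleRepresentation_rationalGaloisRepTate W ℓ :=
  isSemisimpleRepresentation_rationalGaloisRepTate_of_shafarevich W ℓ hSha hbad
    (fun _ ↦ exists_isogeny_ker_eq_and_comp_eq_nsmul_holds W)
    fun _ ↦ linearIndependent_tateModule_map_holds ℓ

/-- **Faltings' Satz 3 for an elliptic curve, down to Siegel's theorem and the isogeny invariance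
of the bad places.** The named fact `isSemisimpleRepresentation_rationalGaloisRepTate W ℓ` follows
from Siegel's finiteness of the `S`-integral points of elliptic curves over `K` (`hSiegel`,
Silverman, *AEC*, Cor. IX.3.2.1, `WeierstrassCurve.siegel_finite_integralPoints K` — whence
Shafarevich's Thm. IX.6.1 through the Mordell curves `y² = x³ + D`,
`WeierstrassCurve.shafarevich_finite_goodReductionOutside_of_finite_mordell` and
`WeierstrassCurve.finite_setOf_sq_eq_cube_add_of_siegel`) and the equality of the bad places of
the curves `K`-isogenous to `E` (`hbad`, *AEC* Cor. VII.7.2), both requested only for curves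
without `K`-rational CM. [cite: Faltings1983Endlichkeit, §5 Satz 3 (proof)] -/
theorem isSemisimpleRepresentation_rationalGaloisRepTate_of_siegel_of_badPlaces
    (hSiegel : ¬ W.HasRationalCM → siegel_finite_integralPoints K)
    (hbad : ¬ W.HasRationalCM → ∀ W' : WeierstrassCurve K, IsIsogenous.badPlaces_eq W W') :
    isSemisimpleRepresentation_rationalGaloisRepTate W ℓ :=
  isSemisimpleRepresentation_rationalGaloisRepTate_of_shafarevich_of_badPlaces W ℓ
    (fun hCM ↦ shafarevich_finite_goodReductionOutside_of_finite_mordell K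
      fun _ hS _ hD ↦ finite_setOf_sq_eq_cube_add_of_siegel (hSiegel hCM) hS hD) hbad

/-- **Faltings' Satz 3 for an elliptic curve, down to Shafarevich's Thm. IX.6.1 and the criterion
of Néron–Ogg–Shafarevich.** The named fact `isSemisimpleRepresentation_rationalGaloisRepTate W ℓ`
follows from Shafarevich's theorem for `K` (`hSha`, *AEC* Thm. IX.6.1) and the criterion of
Néron–Ogg–Shafarevich for the elliptic curves over `K` (`hNOS`, *AEC* Thm. VII.7.1 (c) ⇒ (a),
`WeierstrassCurve.neronOggShafarevich`, whence Cor. VII.7.2 by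
`WeierstrassCurve.IsIsogenous.badPlaces_eq_of_neronOggShafarevich`), both requested only for
curves without `K`-rational CM; the separable quotient isogeny of the tree's
`…_of_shafarevich_of_neronOggShafarevich'` is discharged by
`WeierstrassCurve.exists_separable_isogeny_ker_eq_holds`.
[cite: Faltings1983Endlichkeit, §5 Satz 3 (proof)] -/
theorem isSemisimpleRepresentation_rationalGaloisRepTate_of_shafarevich_of_criterion
    (hSha : ¬ W.HasRationalCM → shafarevich_finite_goodReductionOutside K)
    (hNOS : ¬ W.HasRationalCM → ∀ W' : WeierstrassCurve K, W'.neronOggShafarevich) :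
    isSemisimpleRepresentation_rationalGaloisRepTate W ℓ :=
  isSemisimpleRepresentation_rationalGaloisRepTate_of_shafarevich_of_neronOggShafarevich' W ℓ
    hSha hNOS fun _ ↦ exists_separable_isogeny_ker_eq_holds W

/-- **Faltings' Satz 3 for an elliptic curve, down to its two remaining inputs: Siegel's theorem
and the criterion of Néron–Ogg–Shafarevich.** The named fact
`isSemisimpleRepresentation_rationalGaloisRepTate W ℓ` (Faltings 1983, §5 Satz 3 for `A = E`)
follows from Siegel's theorem for `K` (`hSiegel`, *AEC* Cor. IX.3.2.1,
`WeierstrassCurve.siegel_finite_integralPoints K`) and the criterion of Néron–Ogg–Shafarevich for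
the elliptic curves over `K` (`hNOS`, *AEC* Thm. VII.7.1 (c) ⇒ (a),
`WeierstrassCurve.neronOggShafarevich`), both requested only for curves without `K`-rational CM
— the tree's `…_of_siegel_of_neronOggShafarevich` with its third input, the separable quotient
isogeny *AEC* III.4.12, discharged by `WeierstrassCurve.exists_separable_isogeny_ker_eq_holds`.
[cite: Faltings1983Endlichkeit, §5 Satz 3 (proof)] -/
theorem isSemisimpleRepresentation_rationalGaloisRepTate_of_siegel_of_criterion
    (hSiegel : ¬ W.HasRationalCM → siegel_finite_integralPoints K)
    (hNOS : ¬ W.HasRationalCM → ∀ W' : WeierstrassCurve K, W'.neronOggShafarevich) :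
    isSemisimpleRepresentation_rationalGaloisRepTate W ℓ :=
  isSemisimpleRepresentation_rationalGaloisRepTate_of_siegel_of_neronOggShafarevich W ℓ hSiegel
    hNOS fun _ ↦ exists_separable_isogeny_ker_eq_holds W

/-- **Faltings' Satz 3 for an elliptic curve, down to Siegel's theorem and the local torsion form
of the criterion of Néron–Ogg–Shafarevich.** The named fact
`isSemisimpleRepresentation_rationalGaloisRepTate W ℓ` follows from Siegel's theorem for `K`
(`hSiegel`, *AEC* Cor. IX.3.2.1) and, for the elliptic curves over `K`, the criterion in the
form Thm. VII.7.1 (d) ⇒ (a) over the completions (`hloc`,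
`WeierstrassCurve.hasGoodReductionAt_of_infinite_unramifiedTorsion`: if `E[m] ⊂ E(K̄_v)` is fixed
by the inertia group for infinitely many `m` prime to `v` then `E` has good reduction at `v`),
which gives the global (c) ⇒ (a) by
`WeierstrassCurve.neronOggShafarevich_of_infinite_unramifiedTorsion`; both requested only for
curves without `K`-rational CM. [cite: Faltings1983Endlichkeit, §5 Satz 3 (proof)] -/
theorem isSemisimpleRepresentation_rationalGaloisRepTate_of_siegel_of_localCriterion
    (hSiegel : ¬ W.HasRationalCM → siegel_finite_integralPoints K)
    (hloc : ¬ W.HasRationalCM →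
      ∀ W' : WeierstrassCurve K, W'.hasGoodReductionAt_of_infinite_unramifiedTorsion) :
    isSemisimpleRepresentation_rationalGaloisRepTate W ℓ :=
  isSemisimpleRepresentation_rationalGaloisRepTate_of_siegel_of_criterion W ℓ hSiegel
    fun hCM W' ↦ W'.neronOggShafarevich_of_infinite_unramifiedTorsion (hloc hCM W')

/-! ## One remaining input: Siegel's theorem (2026-08-15)

The criterion of Néron–Ogg–Shafarevich (`WeierstrassCurve.neronOggShafarevich_holds`) and its
corollary VII.7.2 (`WeierstrassCurve.IsIsogenous.badPlaces_eq_holds`) are theorems of the tree, so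
the hypothesis `hNOS` / `hbad` / `hloc` of the forms above is discharged and Faltings' Satz 3 for an
elliptic curve rests on Siegel's theorem alone, through Shafarevich's Thm. IX.6.1 and
Cor. IX.6.2. -/

/-- **Faltings' Satz 3 for an elliptic curve from Shafarevich's Thm. IX.6.1 alone.** The named
fact `isSemisimpleRepresentation_rationalGaloisRepTate W ℓ` (for `E` elliptic over a number field
`K` and any prime `ℓ`, `V_ℓ E` is a semisimple `Γ_K`-representation) follows from Shafarevich's
theorem for `K` (`hSha`, Silverman, *AEC*, Thm. IX.6.1: for `S` finite, the elliptic curves over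
`K` with good reduction outside `S` fall into finitely many `K`-isomorphism classes), requested
only when `E` has no `K`-rational complex multiplication: Cor. IX.6.2 follows from it by the
tree's `WeierstrassCurve.finite_isogenyClass_of_shafarevich` (Cor. VII.7.2 being the theorem
`WeierstrassCurve.IsIsogenous.badPlaces_eq_holds`), and Satz 3 from Cor. IX.6.2 is
`isSemisimpleRepresentation_rationalGaloisRepTate_of_isogenyClass`. (Primed: the tree's
`…_of_shafarevich` of `FaltingsECSemisimpleNumberFieldProofs` is the same deduction with VII.7.2,
III.4.12 and III.7.4 as further hypotheses, all theorems now.)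
[cite: Faltings1983Endlichkeit, §5 Satz 3 (proof)] -/
theorem isSemisimpleRepresentation_rationalGaloisRepTate_of_shafarevich'
    (hSha : ¬ W.HasRationalCM → shafarevich_finite_goodReductionOutside K) :
    isSemisimpleRepresentation_rationalGaloisRepTate W ℓ :=
  isSemisimpleRepresentation_rationalGaloisRepTate_of_isogenyClass W ℓ fun hCM ↦
    finite_isogenyClass_of_shafarevich W (hSha hCM)

/-- **Faltings' Satz 3 for an elliptic curve, down to its one remaining input: Siegel's
theorem.** The named fact `isSemisimpleRepresentation_rationalGaloisRepTate W ℓ` (Faltings 1983,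
§5 Satz 3 for `A = E`: `V_ℓ E` is a semisimple `Γ_K`-representation, `E` elliptic over a number
field `K`) follows from Siegel's finiteness of the `S`-integral points of elliptic curves over `K`
(`hSiegel`, Silverman, *AEC*, Cor. IX.3.2.1, the named fact
`WeierstrassCurve.siegel_finite_integralPoints K`), requested only when `E` has no `K`-rational
complex multiplication. Chain, all proved in the tree: Siegel ⇒ finiteness of the `S`-integral
points of the Mordell curves `y² = x³ + D` ⇒ Shafarevich's Thm. IX.6.1
(`WeierstrassCurve.shafarevich_finite_goodReductionOutside_of_finite_mordell`) ⇒ Cor. IX.6.2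
(`WeierstrassCurve.finite_isogenyClass_of_siegel`, with Cor. VII.7.2 =
`WeierstrassCurve.IsIsogenous.badPlaces_eq_holds`, itself from the criterion of
Néron–Ogg–Shafarevich `WeierstrassCurve.neronOggShafarevich_holds`) ⇒ Tate's argument on the
quotients `E/G_n` of a stable line (`isSemisimpleRepresentation_rationalGaloisRepTate_of_isogenyClass`,
with *AEC* III.4.12 = `WeierstrassCurve.exists_separable_isogeny_ker_eq_holds` and III.7.4 =
`linearIndependent_tateModule_map_holds`); the CM case is unconditional
(`isSemisimpleRepresentation_rationalGaloisRepTate_holds_of_hasRationalCM`). The discharge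
`isSemisimpleRepresentation_rationalGaloisRepTate_holds` is this theorem applied to
`fun _ ↦ siegel_finite_integralPoints_holds K` once Siegel's theorem is a theorem of the tree.
[cite: Faltings1983Endlichkeit, §5 Satz 3 (proof)] -/
theorem isSemisimpleRepresentation_rationalGaloisRepTate_of_siegel
    (hSiegel : ¬ W.HasRationalCM → siegel_finite_integralPoints K) :
    isSemisimpleRepresentation_rationalGaloisRepTate W ℓ :=
  isSemisimpleRepresentation_rationalGaloisRepTate_of_isogenyClass W ℓ fun hCM ↦
    finite_isogenyClass_of_siegel W (hSiegel hCM)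

/-- **Faltings' Satz 3 for an elliptic curve from Siegel's theorem for the curves
`y² = (x - e₁)(x - e₂)(x - e₃)`.** The named fact
`isSemisimpleRepresentation_rationalGaloisRepTate W ℓ` follows from the split monic cubic case of
Silverman, *AEC*, Thm. IX.4.3 over the number fields (in the universe of `K`): `H` — for every
number field `L`, every finite set `T` of finite places of `L` and all pairwise distinct
`e₁, e₂, e₃ ∈ L`, only finitely many `T`-integral `x ∈ L` make `(x - e₁)(x - e₂)(x - e₃)` a
square in `L` — requested only when `E` has no `K`-rational CM. Siegel's Cor. IX.3.2.1 for `K`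
follows from `H` by the tree's `WeierstrassCurve.siegel_finite_integralPoints_of_cubic`
(Cor. IX.4.3.1 with the reduction IX.3.2.2: pass to `K(E[2])`, where the `2`-division cubic
splits), and Satz 3 from it is `isSemisimpleRepresentation_rationalGaloisRepTate_of_siegel`.
[cite: Faltings1983Endlichkeit, §5 Satz 3 (proof)] -/
theorem isSemisimpleRepresentation_rationalGaloisRepTate_of_hyperellipticCubic
    (H : ¬ W.HasRationalCM →
      ∀ (L : Type u) [Field L] [NumberField L] (T : Set (HeightOneSpectrum (𝓞 L))),
        T.Finite → ∀ (e₁ e₂ e₃ : L), e₁ ≠ e₂ → e₁ ≠ e₃ → e₂ ≠ e₃ →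
          {x : L | x ∈ T.integer L ∧ ∃ y : L, y ^ 2 = (x - e₁) * (x - e₂) * (x - e₃)}.Finite) :
    isSemisimpleRepresentation_rationalGaloisRepTate W ℓ :=
  isSemisimpleRepresentation_rationalGaloisRepTate_of_siegel W ℓ fun hCM ↦
    siegel_finite_integralPoints_of_cubic (H hCM)

/-- **Faltings' Satz 3 for an elliptic curve from the `S`-unit equation.** The named fact
`isSemisimpleRepresentation_rationalGaloisRepTate W ℓ` (for `E` elliptic over a number field `K`,
`V_ℓ E` is a semisimple `Γ_K`-representation) follows from the finiteness of the solutions of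
the unit equation `u + v = 1` in `T`-units over the number fields (in the universe of `K`):
`U` — for every number field `F` and every finite set `T` of finite places of `F`, only finitely
many `T`-units `u` admit a `T`-unit `v` with `u + v = 1` (Silverman, *AEC*, Thm. IX.4.1 with
`a = b = 1`; Siegel–Mahler) — requested only when `E` has no `K`-rational CM. Thm. IX.4.3 for the
split monic cubics follows from `U` by the tree's
`Literature.NumberTheory.DiophantineGeometry.finite_integer_sq_eq_cubic_of_unitEquation`
(Siegel's reduction, *AEC* pp. 243–244), and Satz 3 from it is
`isSemisimpleRepresentation_rationalGaloisRepTate_of_hyperellipticCubic`. This is the whole of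
the printed proofs — Faltings' §5 for `g = 1` with Shafarevich's theorem in place of Sätze 1–2,
and Silverman's Ch. IX down to Thm. IX.4.1 — with the unit equation as the one remaining input.
[cite: Faltings1983Endlichkeit, §5 Satz 3 (proof)]
[cite: SilvermanAEC2009, Thm. IX.4.1, Thm. IX.4.3, Cor. IX.4.3.1, Thm. IX.6.1, Cor. IX.6.2] -/
theorem isSemisimpleRepresentation_rationalGaloisRepTate_of_unitEquation
    (U : ¬ W.HasRationalCM →
      ∀ (F : Type u) [Field F] [NumberField F] (T : Set (HeightOneSpectrum (𝓞 F))),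
        T.Finite → {u : Fˣ | u ∈ T.unit F ∧ ∃ v : Fˣ, v ∈ T.unit F ∧ (u : F) + v = 1}.Finite) :
    isSemisimpleRepresentation_rationalGaloisRepTate W ℓ :=
  isSemisimpleRepresentation_rationalGaloisRepTate_of_hyperellipticCubic W ℓ
    fun hCM L _ _ T hT e₁ e₂ e₃ h12 h13 h23 ↦
      Literature.NumberTheory.DiophantineGeometry.finite_integer_sq_eq_cubic_of_unitEquation L
        (U hCM) T hT e₁ e₂ e₃ h12 h13 h23

/-- **The two-input forms collapse.** With the criterion of Néron–Ogg–Shafarevich a theorem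
(`WeierstrassCurve.neronOggShafarevich_holds`), the 2026-08-14 form
`isSemisimpleRepresentation_rationalGaloisRepTate_of_siegel_of_criterion` yields the one-input
form directly; recorded as a second proof of `…_of_siegel`, through Thm. VII.7.1 (c) ⇒ (a) for
the curves over `K` rather than through `IsIsogenous.badPlaces_eq_holds`.
[cite: Faltings1983Endlichkeit, §5 Satz 3 (proof)] -/
theorem isSemisimpleRepresentation_rationalGaloisRepTate_of_siegel'
    (hSiegel : ¬ W.HasRationalCM → siegel_finite_integralPoints K) :
    isSemisimpleRepresentation_rationalGaloisRepTate W ℓ :=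
  isSemisimpleRepresentation_rationalGaloisRepTate_of_siegel_of_criterion W ℓ hSiegel
    fun _ W' ↦ W'.neronOggShafarevich_holds

end Literature.AlgebraicGeometry.Motives

end
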